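import Summits.AtomisticToContinuum.Crystallization.Theorems.FrustratedLawDichotomyBumpNearFieldFiveB
import Summits.AtomisticToContinuum.Crystallization.Theorems.FrustratedLawDichotomyBumpSF45
import Mathlib.Analysis.Convex.Mul

/-!
# FrustratedLawDichotomy · ★★ `SF₅` (the range-5 twin) IS A THEOREM: the near-field certificate assembled (`a = 1`, `w = w₅`, `A = 13/4000`)

Twin of `…BumpSF45` for lens-5 g34's range-5 floor `SF₅ = SchurFloor w₅ ω₅ (13/4000)`: `…BumpKappaFive.sf₅_of_nearIneq5` reduced it to ONE
inequality on `r ∈ (3, 6]`; `…NearFieldFiveA/B` (generated from exact rationals) supply `qpoly5 ≤ s⁻⁵` (`≥ 0`), `mpoly5 ≤ 10/39 − Pbar5`, the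
window integrals `H` and EIGHT Bernstein certificates `r·sec(r)·w₅(r) ≤ 6K₀·H(r)`, `K₀ = 11025/20790`.  This file: `w₅` is the quintic
`10x³ − 15x⁴ + 6x⁵`, `x = (r−3)/2`, on `[3, 5]`; the `s`-integrand, its minorant, window lemmas (kinds A0/A/B/C with window `2`), the secant bound,
the `π`-free constant identity `(512π/3465)·2π·(6M₅)⁻¹ = 11025/20790`, and ★★ `sf₅_holds : SF₅`.
[folklore]; 0 sorry.  Prover hand 1, gen 13 (decomp-a2c), `--supports stmt-AtomisticToContinuum-27623`.
-/

noncomputable section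

namespace Summit.AtomisticToContinuum.Crystallization.Theorems.FrustratedLawDichotomyBumpAutocorrelation

open MeasureTheory Set Real
open scoped BigOperators
open Literature.MathematicalPhysics.StatisticalMechanics (lennardJones)
open Summit.AtomisticToContinuum.Crystallization.Theorems.FrustratedLawDichotomySchurCut
  (omega₂ omega₂_of_two_le SchurFloor tailPot SF₅ w₅ ω₅ cutWeight smoothstep₂ w₅_eq_one w₅_eq_zero)

/-! ## §1. The tail weight on the window -/

/-- On `[3, 5]`: `w₅ r = 10x³ − 15x⁴ + 6x⁵`, `x = (r − 3)/2`. [folklore] -/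
theorem w₅_eq_quintic {r : ℝ} (h1 : 3 ≤ r) (h2 : r ≤ 5) :
    w₅ r = 10 * ((r - 3) / 2) ^ 3 - 15 * ((r - 3) / 2) ^ 4 + 6 * ((r - 3) / 2) ^ 5 := by
  unfold w₅ cutWeight smoothstep₂
  rw [show (5 : ℝ) - 3 = 2 by norm_num]
  have hx0 : 0 ≤ (r - 3) / 2 := by positivity
  have hx1 : (r - 3) / 2 ≤ 1 := by rw [div_le_one (by norm_num)]; linarith
  split_ifs with ha hb
  · have : (r - 3) / 2 = 0 := le_antisymm ha hx0
    rw [this]; norm_num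
  · have : (r - 3) / 2 = 1 := le_antisymm hx1 hb
    rw [this]; norm_num
  · rfl

/-! ## §2. The `s`-integrand: closed form, sign, integrability, minorisation -/

/-- The inner integral in closed form for `|r − s| ≤ 8/5 ≤ r + s`. [folklore] -/
theorem inner5_eq {r s : ℝ} (h1 : |r - s| ≤ 2) (h2 : 2 ≤ r + s) :
    ∫ τ in |r - s|..(r + s), τ * omega₂ τ = 10 / 39 - Pbar5 |r - s| :=
  inner_integral5_eq h1 h2

/-- The inner integral vanishes for `8/5 ≤ |r − s| ≤ r + s`. [folklore] -/
theorem inner5_eq_zero {r s : ℝ} (h : 2 ≤ |r - s|) (hle : |r - s| ≤ r + s) :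
    ∫ τ in |r - s|..(r + s), τ * omega₂ τ = 0 := by
  rw [intervalIntegral.integral_congr (g := fun _ => (0:ℝ)) (fun τ hτ => by
    rw [uIcc_of_le hle] at hτ
    simp [omega₂_of_two_le (show (2:ℝ) ≤ τ by linarith [hτ.1])])]
  simp

/-- The inner integral is nonnegative when `|r − s| ≤ r + s`. [folklore] -/
theorem inner5_nonneg {r s : ℝ} (h : |r - s| ≤ r + s) : 0 ≤ ∫ τ in |r - s|..(r + s), τ * omega₂ τ :=
  intervalIntegral.integral_nonneg h fun _ hτ =>
    mul_nonneg ((abs_nonneg _).trans hτ.1) (omega₂_nonneg ((abs_nonneg _).trans hτ.1))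

/-- The inner integral as a function of `s` is continuous. [folklore] -/
theorem continuous_inner5 (r : ℝ) : Continuous fun s : ℝ => ∫ τ in |r - s|..(r + s), τ * omega₂ τ := by
  have hg : Continuous fun τ : ℝ => τ * omega₂ τ := continuous_id.mul continuous_omega₂
  have hP : Continuous fun x : ℝ => ∫ τ in (0:ℝ)..x, τ * omega₂ τ :=
    intervalIntegral.continuous_primitive (fun a b => hg.intervalIntegrable a b) 0
  have heq : (fun s : ℝ => ∫ τ in |r - s|..(r + s), τ * omega₂ τ) =
      fun s => (∫ τ in (0:ℝ)..(r + s), τ * omega₂ τ) - ∫ τ in (0:ℝ)..|r - s|, τ * omega₂ τ := by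
    funext s
    rw [intervalIntegral.integral_interval_sub_left (hg.intervalIntegrable _ _) (hg.intervalIntegrable _ _)]
  rw [heq]
  exact (hP.comp (by fun_prop)).sub (hP.comp (continuous_abs.comp (by fun_prop)))

/-- The full `s`-integrand. -/
def sInt5 (r s : ℝ) : ℝ := s * kappa5 s * ∫ τ in |r - s|..(r + s), τ * omega₂ τ

/-- `sInt5 r` is continuous. [folklore] -/
theorem continuous_sInt5 (r : ℝ) : Continuous (sInt5 r) := by
  unfold sInt5
  exact (continuous_id.mul continuous_kappa5).mul (continuous_inner5 r)

/-- `sInt5 r s ≥ 0` for `s ≥ 0`, `r ≥ 0`. [folklore] -/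
theorem sInt5_nonneg {r s : ℝ} (hr : 0 ≤ r) (hs : 0 ≤ s) : 0 ≤ sInt5 r s := by
  unfold sInt5
  refine mul_nonneg (mul_nonneg hs (kappa5_nonneg s)) (inner5_nonneg ?_)
  rw [abs_le]; constructor <;> linarith

/-- `sInt5 r s = 0` for `s ≥ r + 8/5` (`r ≥ 0`). [folklore] -/
theorem sInt5_eq_zero {r s : ℝ} (hr : 0 ≤ r) (hs : r + 2 ≤ s) : sInt5 r s = 0 := by
  unfold sInt5
  have habs : |r - s| = s - r := by rw [abs_sub_comm, abs_of_nonneg (by linarith)]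
  rw [inner5_eq_zero (by rw [habs]; linarith) (by rw [habs]; linarith), mul_zero]

/-- `sInt5 r` is integrable on `(0, ∞)` (`r ≥ 0`). [folklore] -/
theorem integrableOn_sInt5 {r : ℝ} (hr : 0 ≤ r) : IntegrableOn (sInt5 r) (Ioi 0) :=
  (integrableOn_Ici_of_eq_zero (continuous_sInt5 r) (a := 0) (fun _ hs => sInt5_eq_zero hr hs)).mono_set Ioi_subset_Ici_self

/-- The minorised integrand `(6M)⁻¹·qpoly(s)·ramp(s)·mpoly5(|r − s|)`. -/
def gInt5 (r s : ℝ) : ℝ := (6 * tailConst5)⁻¹ * (qpoly5 s * ramp5 s * mpoly5 |r - s|)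

/-- `gInt5 r` is continuous. [folklore] -/
theorem continuous_gInt5 (r : ℝ) : Continuous (gInt5 r) := by
  unfold gInt5
  exact continuous_const.mul ((continuous_qpoly5.mul continuous_ramp5).mul (continuous_mpoly5.comp (continuous_abs.comp (by fun_prop))))

/-- On the window: `gInt5 r s ≤ sInt5 r s` (`0 ≤ qpoly ≤ s⁻⁵`, `ramp ≥ 0`, `mpoly ≤` inner integral `= 32/195 − Pbar|r−s| ≥ 0`). [folklore] -/
theorem gInt5_le_sInt5 {r s : ℝ} (hs1 : 18 / 5 ≤ s) (hs2 : s ≤ 8) (hrs : |r - s| ≤ 2) (hr : 3 ≤ r) : gInt5 r s ≤ sInt5 r s := by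
  have hs0 : 0 < s := by linarith
  have hin : ∫ τ in |r - s|..(r + s), τ * omega₂ τ = 10 / 39 - Pbar5 |r - s| := inner5_eq hrs (by linarith)
  have hΩ : 0 ≤ 10 / 39 - Pbar5 |r - s| := by linarith [Pbar5_le (abs_nonneg (r - s)) hrs]
  have hm : mpoly5 |r - s| ≤ 10 / 39 - Pbar5 |r - s| := mpoly5_le (abs_nonneg _) hrs
  have hκ : s * kappa5 s = (6 * tailConst5)⁻¹ * ((s⁻¹) ^ 5 * ramp5 s) := by
    rw [kappa5, max_eq_left (by linarith)]
    field_simp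
  unfold gInt5 sInt5
  rw [hin, hκ]
  have hq := qpoly5_le hs1 hs2
  have hq0 := qpoly5_nonneg hs1 hs2
  have hramp := (ramp5_mem_Icc s).1
  have hM : 0 ≤ (6 * tailConst5)⁻¹ := by have := tailConst5_pos; positivity
  have h1 : qpoly5 s * ramp5 s * mpoly5 |r - s| ≤ qpoly5 s * ramp5 s * (10 / 39 - Pbar5 |r - s|) :=
    mul_le_mul_of_nonneg_left hm (mul_nonneg hq0 hramp)
  have h2 : qpoly5 s * ramp5 s * (10 / 39 - Pbar5 |r - s|) ≤ (s⁻¹) ^ 5 * ramp5 s * (10 / 39 - Pbar5 |r - s|) :=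
    mul_le_mul_of_nonneg_right (mul_le_mul_of_nonneg_right hq hramp) hΩ
  nlinarith [h1, h2, hM]

/-- ★ **The `s`-integral dominates the minorised window integral**: for `3 ≤ r`, `lo ≥ 67/20`, `r − 8/5 ≤ lo ≤ r + 8/5 ≤ 141/20`:
`∫_{lo}^{r+8/5} gInt5 r ≤ ∫_{s>0} sInt5 r`. [folklore] -/
theorem window_le_integral5 {r lo : ℝ} (hr : 3 ≤ r) (hlo1 : 18 / 5 ≤ lo) (hlo2 : r - 2 ≤ lo) (hlo3 : lo ≤ r + 2)
    (hhi : r + 2 ≤ 8) :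
    ∫ s in lo..(r + 2), gInt5 r s ≤ ∫ s in Ioi 0, sInt5 r s := by
  have hr0 : 0 ≤ r := by linarith
  have h1 : ∫ s in lo..(r + 2), gInt5 r s ≤ ∫ s in lo..(r + 2), sInt5 r s := by
    refine intervalIntegral.integral_mono_on hlo3 ((continuous_gInt5 r).intervalIntegrable _ _)
      ((continuous_sInt5 r).intervalIntegrable _ _) fun s hs => ?_
    refine gInt5_le_sInt5 (by linarith [hs.1]) (by linarith [hs.2]) ?_ hr
    rw [abs_le]; constructor <;> linarith [hs.1, hs.2]
  have h2 : ∫ s in lo..(r + 2), sInt5 r s ≤ ∫ s in Ioi 0, sInt5 r s := by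
    rw [intervalIntegral.integral_of_le hlo3]
    refine setIntegral_mono_set (integrableOn_sInt5 hr0) ?_ (Filter.Eventually.of_forall fun s hs => lt_trans (show (0:ℝ) < lo by linarith) hs.1)
    exact (ae_restrict_iff' measurableSet_Ioi).mpr (Filter.Eventually.of_forall fun s (hs : 0 < s) => sInt5_nonneg hr0 hs.le)
  exact h1.trans h2

/-! ## §3. The window integral in closed form (three kinds) and the certificate -/

/-- Kind A0 (`3 < r ≤ 67/20`): `∫_{67/20}^{r+8/5} gInt5 r = (6M)⁻¹ (GA01 + GA02)(r)`. [folklore] -/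
theorem window5_A0 {r : ℝ} (h1 : 3 ≤ r) (h2 : r ≤ 18 / 5) :
    ∫ s in (18 / 5 : ℝ)..(r + 2), gInt5 r s = (6 * tailConst5)⁻¹ * (HA01 r + HA02 r) := by
  have hc := continuous_gInt5 r
  rw [← intervalIntegral.integral_add_adjacent_intervals (hc.intervalIntegrable (18 / 5) (4)) (hc.intervalIntegrable (4) (r + 2))]
  have e1 : ∫ s in (18 / 5 : ℝ)..(4), gInt5 r s = (6 * tailConst5)⁻¹ * HA01 r := by
    rw [← integral_HA01, ← intervalIntegral.integral_const_mul]
    refine intervalIntegral.integral_congr fun s hs => ?_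
    rw [uIcc_of_le (by norm_num)] at hs
    simp only [gInt5]
    rw [ramp5_of_mem hs.1 hs.2, abs_of_nonpos (by linarith [hs.1]), neg_sub, ← integrand_cR4]
  have e2 : ∫ s in (4 : ℝ)..(r + 2), gInt5 r s = (6 * tailConst5)⁻¹ * HA02 r := by
    rw [← integral_HA02, ← intervalIntegral.integral_const_mul]
    refine intervalIntegral.integral_congr fun s hs => ?_
    rw [uIcc_of_le (by linarith)] at hs
    simp only [gInt5]
    rw [ramp5_of_ge hs.1, mul_one, abs_of_nonpos (by linarith [hs.1]), neg_sub, ← integrand_cR3]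
  rw [e1, e2]; ring

/-- Kind A (`67/20 ≤ r ≤ 77/20`): `∫_{67/20}^{r+8/5} gInt5 r = (6M)⁻¹ (GA1 + GA2 + GA3)(r)`. [folklore] -/
theorem window5_A {r : ℝ} (h1 : 18 / 5 ≤ r) (h2 : r ≤ 4) :
    ∫ s in (18 / 5 : ℝ)..(r + 2), gInt5 r s = (6 * tailConst5)⁻¹ * (HA1 r + HA2 r + HA3 r) := by
  have hc := continuous_gInt5 r
  rw [← intervalIntegral.integral_add_adjacent_intervals (hc.intervalIntegrable (18 / 5) r) (hc.intervalIntegrable r (r + 2)),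
    ← intervalIntegral.integral_add_adjacent_intervals (hc.intervalIntegrable r (4)) (hc.intervalIntegrable (4) (r + 2))]
  have e1 : ∫ s in (18 / 5 : ℝ)..r, gInt5 r s = (6 * tailConst5)⁻¹ * HA1 r := by
    rw [← integral_HA1, ← intervalIntegral.integral_const_mul]
    refine intervalIntegral.integral_congr fun s hs => ?_
    rw [uIcc_of_le h1] at hs
    simp only [gInt5]
    rw [ramp5_of_mem hs.1 (by linarith [hs.2]), abs_of_nonneg (by linarith [hs.2]), ← integrand_cR1]
  have e2 : ∫ s in r..(4 : ℝ), gInt5 r s = (6 * tailConst5)⁻¹ * HA2 r := by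
    rw [← integral_HA2, ← intervalIntegral.integral_const_mul]
    refine intervalIntegral.integral_congr fun s hs => ?_
    rw [uIcc_of_le h2] at hs
    simp only [gInt5]
    rw [ramp5_of_mem (by linarith [hs.1]) hs.2, abs_of_nonpos (by linarith [hs.1]), neg_sub, ← integrand_cR4]
  have e3 : ∫ s in (4 : ℝ)..(r + 2), gInt5 r s = (6 * tailConst5)⁻¹ * HA3 r := by
    rw [← integral_HA3, ← intervalIntegral.integral_const_mul]
    refine intervalIntegral.integral_congr fun s hs => ?_
    rw [uIcc_of_le (by linarith)] at hs
    simp only [gInt5]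
    rw [ramp5_of_ge hs.1, mul_one, abs_of_nonpos (by linarith [hs.1]), neg_sub, ← integrand_cR3]
  rw [e1, e2, e3]; ring

/-- Kind B (`77/20 ≤ r`; used for `r ≤ 99/20`): `∫_{67/20}^{r+8/5} gInt5 r = (6M)⁻¹ (GB1 + GB2 + GB3)(r)`. [folklore] -/
theorem window5_B {r : ℝ} (h1 : 4 ≤ r) :
    ∫ s in (18 / 5 : ℝ)..(r + 2), gInt5 r s = (6 * tailConst5)⁻¹ * (HB1 r + HB2 r + HB3 r) := by
  have hc := continuous_gInt5 r
  rw [← intervalIntegral.integral_add_adjacent_intervals (hc.intervalIntegrable (18 / 5) r) (hc.intervalIntegrable r (r + 2)),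
    ← intervalIntegral.integral_add_adjacent_intervals (hc.intervalIntegrable (18 / 5) (4)) (hc.intervalIntegrable (4) r)]
  have e1 : ∫ s in (18 / 5 : ℝ)..(4), gInt5 r s = (6 * tailConst5)⁻¹ * HB1 r := by
    rw [← integral_HB1, ← intervalIntegral.integral_const_mul]
    refine intervalIntegral.integral_congr fun s hs => ?_
    rw [uIcc_of_le (by norm_num)] at hs
    simp only [gInt5]
    rw [ramp5_of_mem hs.1 hs.2, abs_of_nonneg (by linarith [hs.2]), ← integrand_cR1]
  have e2 : ∫ s in (4 : ℝ)..r, gInt5 r s = (6 * tailConst5)⁻¹ * HB2 r := by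
    rw [← integral_HB2, ← intervalIntegral.integral_const_mul]
    refine intervalIntegral.integral_congr fun s hs => ?_
    rw [uIcc_of_le h1] at hs
    simp only [gInt5]
    rw [ramp5_of_ge hs.1, mul_one, abs_of_nonneg (by linarith [hs.2]), ← integrand_cR2]
  have e3 : ∫ s in r..(r + 2), gInt5 r s = (6 * tailConst5)⁻¹ * HB3 r := by
    rw [← integral_HB3, ← intervalIntegral.integral_const_mul]
    refine intervalIntegral.integral_congr fun s hs => ?_
    rw [uIcc_of_le (by linarith)] at hs
    simp only [gInt5]
    rw [ramp5_of_ge (by linarith [hs.1]), mul_one, abs_of_nonpos (by linarith [hs.1]), neg_sub, ← integrand_cR3]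
  rw [e1, e2, e3]; ring

/-- Kind C (`99/20 ≤ r ≤ 109/20`): `∫_{r−8/5}^{r+8/5} gInt5 r = (6M)⁻¹ (GC1 + GC2 + GC3)(r)`. [folklore] -/
theorem window5_C {r : ℝ} (h1 : 28 / 5 ≤ r) (h2 : r ≤ 6) :
    ∫ s in (r - 2)..(r + 2), gInt5 r s = (6 * tailConst5)⁻¹ * (HC1 r + HC2 r + HC3 r) := by
  have hc := continuous_gInt5 r
  rw [← intervalIntegral.integral_add_adjacent_intervals (hc.intervalIntegrable (r - 2) r) (hc.intervalIntegrable r (r + 2)),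
    ← intervalIntegral.integral_add_adjacent_intervals (hc.intervalIntegrable (r - 2) (4)) (hc.intervalIntegrable (4) r)]
  have e1 : ∫ s in (r - 2)..(4 : ℝ), gInt5 r s = (6 * tailConst5)⁻¹ * HC1 r := by
    rw [← integral_HC1, ← intervalIntegral.integral_const_mul]
    refine intervalIntegral.integral_congr fun s hs => ?_
    rw [uIcc_of_le (by linarith)] at hs
    simp only [gInt5]
    rw [ramp5_of_mem (by linarith [hs.1]) hs.2, abs_of_nonneg (by linarith [hs.2]), ← integrand_cR1]
  have e2 : ∫ s in (4 : ℝ)..r, gInt5 r s = (6 * tailConst5)⁻¹ * HC2 r := by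
    rw [← integral_HC2, ← intervalIntegral.integral_const_mul]
    refine intervalIntegral.integral_congr fun s hs => ?_
    rw [uIcc_of_le (by linarith)] at hs
    simp only [gInt5]
    rw [ramp5_of_ge hs.1, mul_one, abs_of_nonneg (by linarith [hs.2]), ← integrand_cR2]
  have e3 : ∫ s in r..(r + 2), gInt5 r s = (6 * tailConst5)⁻¹ * HC3 r := by
    rw [← integral_HC3, ← intervalIntegral.integral_const_mul]
    refine intervalIntegral.integral_congr fun s hs => ?_
    rw [uIcc_of_le (by linarith)] at hs
    simp only [gInt5]
    rw [ramp5_of_ge (by linarith [hs.1]), mul_one, abs_of_nonpos (by linarith [hs.1]), neg_sub, ← integrand_cR3]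
  rw [e1, e2, e3]; ring

/-- The constant: `(4/5)³·(512π/3465)·(2π)·(6M)⁻¹ = K₀ = (11025/20790)/(4/5)³` (`π` cancels). [folklore] -/
theorem const_identity5 : (512 * π / 3465) * (2 * π) * (6 * tailConst5)⁻¹ = 11025 / 20790 := by
  unfold tailConst5
  have hπ : π ≠ 0 := Real.pi_ne_zero
  field_simp
  ring

-- (the secant bound `inv_pow_six_le_secant` is the tree lemma of `…BumpSF45`)

/-- From a certificate `r·sec(r)·w ≤ 6K₀·Gs` (with `w = w₄₅ r`, `sec` the secant of `r⁻⁶` on `[u, v] ∋ r`) and the window bound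
`(6M)⁻¹·Gs ≤ ∫_{s>0} sInt5 r` to the near-field inequality at `r`. [folklore] -/
theorem near_of_cert5 {u v r Gs wv : ℝ} (hu : 0 < u) (huv : u < v) (h1 : u ≤ r) (h2 : r ≤ v) (hr : 3 < r) (hwv : w₅ r = wv)
    (hF : r * (((u⁻¹) ^ 6 * (v - r) + (v⁻¹) ^ 6 * (r - u)) / (v - u)) * wv ≤ 6 * (11025 / 20790 : ℝ) * Gs)
    (hwin : (6 * tailConst5)⁻¹ * Gs ≤ ∫ s in Ioi 0, sInt5 r s) :
    -(tailPot w₅ r) ≤ 512 * π / 3465 *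
      (2 * π / r * ∫ s in Ioi 0, s * kappa5 s * ∫ τ in |r - s|..(r + s), τ * omega₂ τ) := by
  have hr0 : 0 < r := by linarith
  subst hwv
  have hI : ∫ s in Ioi 0, s * kappa5 s * ∫ τ in |r - s|..(r + s), τ * omega₂ τ = ∫ s in Ioi 0, sInt5 r s := rfl
  rw [hI]
  have hw := w₅_mem_Icc r
  -- step 1: −(V·w)(r) ≤ (r⁻¹)^6/6 · w
  have hL : -(tailPot w₅ r) ≤ (r⁻¹) ^ 6 / 6 * w₅ r := by
    unfold tailPot lennardJones
    have hy : 0 ≤ (r⁻¹) ^ 12 := by positivity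
    nlinarith [hw.1, hw.2, hy, mul_nonneg hy hw.1]
  -- step 2: secant
  have hsec := inv_pow_six_le_secant hu huv h1 h2
  have hL2 : (r⁻¹) ^ 6 / 6 * w₅ r ≤ (((u⁻¹) ^ 6 * (v - r) + (v⁻¹) ^ 6 * (r - u)) / (v - u)) / 6 * w₅ r :=
    mul_le_mul_of_nonneg_right (div_le_div_of_nonneg_right hsec (by norm_num)) hw.1
  -- step 3: certificate and window
  have hC : 0 ≤ (512 * π / 3465) * (2 * π / r) := by positivity
  have hK := const_identity5
  calc -(tailPot w₅ r) ≤ (((u⁻¹) ^ 6 * (v - r) + (v⁻¹) ^ 6 * (r - u)) / (v - u)) / 6 * w₅ r := hL.trans hL2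
    _ = (r * (((u⁻¹) ^ 6 * (v - r) + (v⁻¹) ^ 6 * (r - u)) / (v - u)) * w₅ r) / (6 * r) := by field_simp
    _ ≤ (6 * (11025 / 20790 : ℝ) * Gs) / (6 * r) := div_le_div_of_nonneg_right hF (by positivity)
    _ = (512 * π / 3465) * (2 * π / r) * ((6 * tailConst5)⁻¹ * Gs) := by
        rw [show (6 * tailConst5)⁻¹ = 11025 / 20790 / ((512 * π / 3465) * (2 * π)) by
          rw [← hK]; field_simp]
        field_simp
    _ ≤ (512 * π / 3465) * (2 * π / r) * ∫ s in Ioi 0, sInt5 r s := mul_le_mul_of_nonneg_left hwin hC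
    _ = _ := by ring

/-- ★★ **`SF₅` HOLDS** — lens-5 g34's range-5 Schur tail floor `SchurFloor w₅ ω₅ (13/4000)`: for EVERY finite configuration of points in `ℝ³`,
`−(13/4000)·(N + 2·Σ_{i<j} ω₅(r_ij)) ≤ Σ_{i<j} (V·w₅)(r_ij)`. [folklore: Schur test + certified elementary one-variable inequality] -/
theorem sf₅_holds : SF₅ := by
  refine sf₅_of_nearIneq5 fun r hr1 hr2 => ?_
  have hr3 : 3 ≤ r := hr1.le
  have winA0 : r ≤ 18 / 5 → (6 * tailConst5)⁻¹ * (HA01 r + HA02 r) ≤ ∫ s in Ioi 0, sInt5 r s := fun h => by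
    rw [← window5_A0 hr3 h]; exact window_le_integral5 hr3 le_rfl (by linarith) (by linarith) (by linarith)
  have winA : 18 / 5 ≤ r → r ≤ 4 → (6 * tailConst5)⁻¹ * (HA1 r + HA2 r + HA3 r) ≤ ∫ s in Ioi 0, sInt5 r s := fun h h' => by
    rw [← window5_A h h']; exact window_le_integral5 hr3 le_rfl (by linarith) (by linarith) (by linarith)
  have winB : 4 ≤ r → r ≤ 28 / 5 → (6 * tailConst5)⁻¹ * (HB1 r + HB2 r + HB3 r) ≤ ∫ s in Ioi 0, sInt5 r s := fun h h' => by
    rw [← window5_B h]; exact window_le_integral5 hr3 le_rfl (by linarith) (by linarith) (by linarith)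
  have winC : 28 / 5 ≤ r → r ≤ 6 → (6 * tailConst5)⁻¹ * (HC1 r + HC2 r + HC3 r) ≤ ∫ s in Ioi 0, sInt5 r s := fun h h' => by
    rw [← window5_C h h']; exact window_le_integral5 hr3 (by linarith) le_rfl (by linarith) (by linarith)
  rcases le_or_gt r (18 / 5) with c1 | c1
  · exact near_of_cert5 (by norm_num) (by norm_num) hr3 c1 hr1 (w₅_eq_quintic hr3 (by linarith)) (cert5_1 hr3 c1) (winA0 c1)
  rcases le_or_gt r (19 / 5) with c2 | c2
  · exact near_of_cert5 (by norm_num) (by norm_num) c1.le c2 hr1 (w₅_eq_quintic hr3 (by linarith)) (cert5_2 c1.le c2) (winA c1.le (by linarith))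
  rcases le_or_gt r 4 with c3 | c3
  · exact near_of_cert5 (by norm_num) (by norm_num) c2.le c3 hr1 (w₅_eq_quintic hr3 (by linarith)) (cert5_3 c2.le c3) (winA (by linarith) c3)
  rcases le_or_gt r (17 / 4) with c4 | c4
  · exact near_of_cert5 (by norm_num) (by norm_num) c3.le c4 hr1 (w₅_eq_quintic hr3 (by linarith)) (cert5_4 c3.le c4) (winB c3.le (by linarith))
  rcases le_or_gt r (9 / 2) with c5 | c5
  · exact near_of_cert5 (by norm_num) (by norm_num) c4.le c5 hr1 (w₅_eq_quintic hr3 (by linarith)) (cert5_5 c4.le c5) (winB (by linarith) (by linarith))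
  rcases le_or_gt r 5 with c6 | c6
  · exact near_of_cert5 (by norm_num) (by norm_num) c5.le c6 hr1 (w₅_eq_quintic hr3 c6) (cert5_6 c5.le c6) (winB (by linarith) (by linarith))
  rcases le_or_gt r (28 / 5) with c7 | c7
  · exact near_of_cert5 (by norm_num) (by norm_num) c6.le c7 hr1 (w₅_eq_one c6.le) (cert5_7 c6.le c7) (winB (by linarith) c7)
  · exact near_of_cert5 (by norm_num) (by norm_num) c7.le hr2 hr1 (w₅_eq_one (by linarith)) (cert5_8 c7.le hr2) (winC c7.le hr2)

end Summit.AtomisticToContinuum.Crystallization.Theorems.FrustratedLawDichotomyBumpAutocorrelation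

end
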